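import Mathlib.LinearAlgebra.Matrix.SchurComplement
import Mathlib.Data.Matrix.ColumnRowPartitioned
import Mathlib.Analysis.SpecialFunctions.Log.Basic
import Literature.MathematicalPhysics.QuantumFieldTheory.Balaban1983to89.Beta.CompositionSingular

/-!
# Road FP (binder row D1), leaf H2-GH part 2 (owner ruling R-FP-18 (b)): THE GHOST DETERMINANT AT MODEL LEVEL —
# WHICH determinant the Faddeev–Popov factor `|det(Δ↾N(Q′))|⁻¹` of [B9 (3.121)] is, the least-squares projection of [B5 (1.24)–(1.28)],
# and the cell's typed δ-constrained Gaussian `logZ` (pv25's `Beta.Composition`) — finite-dimensional linear algebra, nothing cited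

HONEST DEPENDENCY (page 1, mandatory): continuum YM on T⁴ ⇐ BetaPertH ∧ nine spine estimates (0/9 proved); BetaPertH ⇐ (D1) ∧ (D4) ∧
CAP+tail; G-an2-4 gates asym, D1 and NE2/3/4.  HONEST FRAMING (cell contract, verbatim): «discharging `BetaPertH` makes Bałaban's UV
stability UNCONDITIONAL — a real constructive-QFT result; it is NOT the continuum limit and NOT the Clay problem.»  THIS MODULE is [folklore]
matrix algebra over Mathlib and pv25's `Beta.Composition` ∕ `Beta.CompositionSingular` (`kkt`, `det_kkt'`, `logZ`, `blockProp`, `flucCov`,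
`kkt_mul_blocks`, `blocks_mul_kkt`, `minOpL_eq_transpose`, all BY NAME); ONE [our object] data definition (`ghostLogDet`), no `def … : Prop`,
nothing of the audited series enters as a hypothesis, 0 sorry.  The two quotations below only fix WHICH determinant is being modelled.
0∕4 binders of row D1; NOT D1, NOT BetaPertH, NOT continuum, NOT Clay.

ABSOLUTE RULE (cell charter, verbatim): «No internally-minted statement may enter as a cited fact. Every hypothesis is either kernel-proved
in this package or a verbatim quotation of a PUBLISHED theorem with page reference. The manuscript(s) under audit are NOT citable for their
own disputed steps — they are the thing under adjudication; programme-internal (2001/route/tribunal) claims are never citable.»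

THE TWO PRINTED LOCI (renders read 2026-08-20).  [B5] T. Bałaban, *Propagators and renormalization transformations for lattice gauge
theories. I*, Commun. Math. Phys. **95** (1984) 17–40, p. 21–22 (1.24)–(1.28): the Faddeev–Popov insertion integrates
`∫dλ δ(Q′λ) exp(−(1∕2α)‖d^*A − Δλ‖²)`; the minimiser is `λ₀ = Δ⁻¹d^*A − Δ⁻²Q′^*(Q′Δ⁻²Q′^*)⁻¹Q′Δ⁻¹d^*A`, the weight left behind is
`exp(−(1∕2α)‖Δ⁻¹Q′^*(Q′Δ⁻²Q′^*)⁻¹Q′Δ⁻¹d^*A‖²)` (1.28), and «the operator `I − Δ⁻¹Q′^*(Q′Δ⁻²Q′^*)⁻¹Q′Δ⁻¹` is a projection».  [B9] T. Bałaban,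
*Propagators for lattice gauge theories in a background field*, Commun. Math. Phys. **99** (1985) 389–434, p. 419 (3.118)–(3.121): «we have used
the identity `RD^*(A − Dλ) = RD^*A − RΔλ = RD^*A − Δλ`, which holds by the definition of `R` and the fact that `λ ∈ N(Q′)`», and the sharp-slice
insertion `∫dλ δ(Q′λ) δ_R(RD^*A + Δλ)` produces the factor `|det(Δ↾N(Q′))|⁻¹` in (3.121).

WHAT IS MODELLED AND WHAT IS PROVED (abstract: `ν` fine index, `μ` coarse index, a square `L : Matrix ν ν` in the role of `Δ_U`, `Q : Matrix μ ν`
in the role of `Q′`, `N(Q) := ker Q`; an ORTHONORMAL KERNEL FRAME is `ι : Matrix ν κ` with `ιᵀι = 1`, `Qι = 0`, `ιιᵀ + Qᵀ(QQᵀ)⁻¹Q = 1`).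
* §1 **COMPRESSION LEMMA** `det_kkt_eq_frame` (any field): `det [[K, Qᵀ],[Q, 0]] = (−1)^{|μ|}·det(QQᵀ)·det(ιᵀKι)` — the bordered (KKT)
  determinant of pv25's `logZ` IS, up to the constraint Gram factor, the determinant of the COMPRESSION of `K` to `N(Q)` (shear invariance of
  the bordered determinant, Weinstein–Aronszajn `det(1+XY) = det(1+YX)`, pv25's Schur formula `det_kkt`).
* §2 **B5's LEAST SQUARES ON `N(Q)`** with pv25's `flucCov`: `lsq L Q b := flucCov (LᵀL) Q (Lᵀ b)` lies in `N(Q)` (`mul_lsq_eq_zero`); the residual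
  operator `resPrj L Q := 1 − L·flucCov (LᵀL) Q·Lᵀ` (B5's `Δ⁻¹Q′^*(Q′Δ⁻²Q′^*)⁻¹Q′Δ⁻¹` of (1.28); B9's `R = 1 − resPrj`, `R L v = L v` on `N(Q)` =
  `resPrj_mul_L_mulVec`) is a symmetric idempotent, and **COMPLETING THE SQUARE** `normSq_residual`:
  `‖b − Lλ‖² = ‖resPrj b‖² + ‖L(λ − lsq b)‖²` for every `λ ∈ N(Q)` — so B5's Gaussian (1.24) factorises into the weight `e^{−‖resPrj b‖²∕2α}` and a
  `b`-INDEPENDENT volume, the Gaussian `∫_{N(Q)} e^{−½‖Lμ‖²}dμ` with quadratic form `LᵀL` constrained by `Q`.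
* §3 [our object] **`ghostLogDet L Q := ½·(log|det kkt (LᵀL) Q| − log|det(QQᵀ)|)`** and the DISPLAYS:
  (a) `ghostLogDet_eq_frame`: `= ½·log det(ιᵀLᵀLι)` — the log-volume-ratio of `L : N(Q) → L·N(Q)` between the two `|κ|`-planes (B9's `R`-plane
      contains `L·N(Q)`): THIS is the `|det(Δ↾N(Q′))|` of (3.121) read through «`RΔλ = Δλ` on `N(Q′)`» and the `δ_R` on the range of `R`;
  (b) `ghostLogDet_eq_jacobi`: `= log|det L| + ½·log|det(Q(LᵀL)⁻¹Qᵀ)| − ½·log|det(QQᵀ)|` — B5's operator `Q′Δ⁻²Q′^*` of (1.26);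
  (c) `logZ_transpose_mul_self`: pv25's typed Gaussian `logZ (LᵀL) Q = ((|ν|−|μ|)∕2)·log 2π − ghostLogDet L Q − ½·log|det(QQᵀ)|` — «TYPE the
      Gaussian `∫_{N(Q′)}dλ e^{−½‖RD^*A − Δ_Uλ‖²}` as the definition and DISPLAY its relation to the compression determinant» (R-FP-18 (b)) in
      the cell's algebraic model of δ-constrained Gaussians (the measure-theoretic evaluation is GAPS C-beta-6, not this file);
  (d) (R7) LOCATED: the COMPRESSION determinant `det(ιᵀLι)` is `(−1)^{|μ|}det kkt L Q ∕ det(QQᵀ)` (`det_kkt_eq_frame` with `K := L`) and is NOT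
      the square root of (a)'s in general — `frame_example` : on `ν = Fin 2`, `Q = (1 0)`, `L = [[1,1],[1,2]]`: `det(ιᵀLᵀLι) = 5`, `det(ιᵀLι) = 2`.
Unit `b2b-balaban-beta-d1-formalise-leaf-06` (gen 6), 2026-08-20; `LEAVES-FP.md` row H2-GH; R-FP-18 (b); CLAIM «H2-GH part 2» (journal).
-/

namespace Summit.QuantumFields.BalabanUV.Beta.FP.GhostDeterminantModel

open Matrix
open scoped Matrix BigOperators
open Literature.MathematicalPhysics.QuantumFieldTheory.Balaban1983to89.Beta
open Literature.MathematicalPhysics.QuantumFieldTheory.Balaban1983to89.Beta.Composition (kkt blockProp det_kkt det_kkt' logZ)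
open Literature.MathematicalPhysics.QuantumFieldTheory.Balaban1983to89.Beta.CompositionSingular (flucCov minOp minOpL kkt_eq_fromBlocks
  kkt_mul_blocks blocks_mul_kkt mul_flucCov flucCov_mul_transpose minOpL_eq_transpose)

noncomputable section

variable {𝕜 : Type*} [Field 𝕜]
variable {ν μ κ : Type*} [Fintype ν] [Fintype μ] [Fintype κ] [DecidableEq ν] [DecidableEq μ] [DecidableEq κ]

/-! ## §1 The compression lemma: `det kkt K Q = (−1)^{|μ|}·det(QQᵀ)·det(ιᵀKι)` for an orthonormal kernel frame `ι` -/

/-- [folklore] Shear invariance I: adding `QᵀX` to the form does not change the bordered determinant. -/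
theorem det_kkt_add_transpose_mul (K : Matrix ν ν 𝕜) (Q : Matrix μ ν 𝕜) (X : Matrix μ ν 𝕜) :
    (kkt (K + Qᵀ * X) Q).det = (kkt K Q).det := by
  have e : kkt (K + Qᵀ * X) Q = kkt K Q * fromBlocks 1 0 X 1 := by
    rw [kkt_eq_fromBlocks, kkt_eq_fromBlocks, fromBlocks_multiply]
    simp
  rw [e, det_mul, det_fromBlocks_zero₁₂, det_one, det_one, mul_one, mul_one]

/-- [folklore] Shear invariance II: adding `YQ` to the form does not change the bordered determinant. -/
theorem det_kkt_add_mul (K : Matrix ν ν 𝕜) (Q : Matrix μ ν 𝕜) (Y : Matrix ν μ 𝕜) :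
    (kkt (K + Y * Q) Q).det = (kkt K Q).det := by
  have e : kkt (K + Y * Q) Q = fromBlocks 1 Y 0 1 * kkt K Q := by
    rw [kkt_eq_fromBlocks, kkt_eq_fromBlocks, fromBlocks_multiply]
    simp
  rw [e, det_mul, det_fromBlocks_zero₂₁, det_one, det_one, mul_one, one_mul]

/-- [folklore] **THE COMPRESSION LEMMA.**  For an orthonormal kernel frame `ι` of `Q` (`ιᵀι = 1`, `Qι = 0`, completeness
`ιιᵀ + Qᵀ(QQᵀ)⁻¹Q = 1`, `QQᵀ` invertible) and `K` nondegenerate on the frame (`ιᵀKι` invertible):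
`det [[K, Qᵀ],[Q, 0]] = (−1)^{|μ|} · det(QQᵀ) · det(ιᵀKι)`. -/
theorem det_kkt_eq_frame (K : Matrix ν ν 𝕜) (Q : Matrix μ ν 𝕜) (ι : Matrix ν κ 𝕜) (hιι : ιᵀ * ι = 1) (hQι : Q * ι = 0)
    (hG : IsUnit (Q * Qᵀ).det) (hc : ι * ιᵀ + Qᵀ * (Q * Qᵀ)⁻¹ * Q = 1) (hA : IsUnit (ιᵀ * K * ι).det) :
    (kkt K Q).det = (-1) ^ Fintype.card μ * ((Q * Qᵀ).det * (ιᵀ * K * ι).det) := by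
  set A : Matrix κ κ 𝕜 := ιᵀ * K * ι with hAdef
  set C : Matrix μ μ 𝕜 := (Q * Qᵀ)⁻¹ with hCdef
  set P : Matrix ν ν 𝕜 := ι * ιᵀ with hPdef
  have hιQ : ιᵀ * Qᵀ = 0 := by rw [← transpose_mul, hQι, transpose_zero]
  have hGC : Q * Qᵀ * C = 1 := mul_nonsing_inv _ hG
  have hCG : C * (Q * Qᵀ) = 1 := nonsing_inv_mul _ hG
  have hPι : P * ι = ι := by rw [hPdef, Matrix.mul_assoc, hιι, Matrix.mul_one]
  have hιP : ιᵀ * P = ιᵀ := by rw [hPdef, ← Matrix.mul_assoc, hιι, Matrix.one_mul]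
  have hPQ : P * Qᵀ = 0 := by rw [hPdef, Matrix.mul_assoc, hιQ, Matrix.mul_zero]
  have hQP : Q * P = 0 := by rw [hPdef, ← Matrix.mul_assoc, hQι, Matrix.zero_mul]
  have h1P : 1 - P = Qᵀ * C * Q := by rw [← hc]; simp [hPdef]
  -- the modified form `H′ := PKP + QᵀQ` differs from `K` by shears
  set H' : Matrix ν ν 𝕜 := P * K * P + Qᵀ * Q with hH'def
  have hshear : H' = K + Qᵀ * (-(C * Q * K) + C * Q * K * Qᵀ * C * Q + Q) + (-(K * Qᵀ * C)) * Q := by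
    have eP : P = 1 - Qᵀ * C * Q := by rw [← h1P, sub_sub_cancel]
    rw [hH'def, eP]
    simp only [Matrix.sub_mul, Matrix.mul_sub, Matrix.one_mul, Matrix.mul_one, Matrix.mul_add, Matrix.mul_neg, Matrix.neg_mul,
      Matrix.mul_assoc]
    abel
  have hdet1 : (kkt H' Q).det = (kkt K Q).det := by
    rw [hshear, det_kkt_add_mul, det_kkt_add_transpose_mul]
  -- `H′` is invertible with inverse `ιA⁻¹ιᵀ + QᵀC²Q`
  have hAinv : A * A⁻¹ = 1 := mul_nonsing_inv _ hA
  have hinv : H' * (ι * A⁻¹ * ιᵀ + Qᵀ * C * C * Q) = 1 := by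
    have e1 : P * K * P * (ι * A⁻¹ * ιᵀ) = P := by
      calc P * K * P * (ι * A⁻¹ * ιᵀ) = P * K * (P * ι) * A⁻¹ * ιᵀ := by simp only [Matrix.mul_assoc]
        _ = ι * (ιᵀ * K * ι) * A⁻¹ * ιᵀ := by rw [hPι, hPdef]; simp only [Matrix.mul_assoc]
        _ = P := by rw [← hAdef, Matrix.mul_assoc ι, hAinv, Matrix.mul_one, hPdef]
    have e2 : P * K * P * (Qᵀ * C * C * Q) = 0 := by
      calc P * K * P * (Qᵀ * C * C * Q) = P * K * (P * Qᵀ) * C * C * Q := by simp only [Matrix.mul_assoc]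
        _ = 0 := by rw [hPQ]; simp
    have e3 : Qᵀ * Q * (ι * A⁻¹ * ιᵀ) = 0 := by
      calc Qᵀ * Q * (ι * A⁻¹ * ιᵀ) = Qᵀ * (Q * ι) * A⁻¹ * ιᵀ := by simp only [Matrix.mul_assoc]
        _ = 0 := by rw [hQι]; simp
    have e4 : Qᵀ * Q * (Qᵀ * C * C * Q) = Qᵀ * C * Q := by
      calc Qᵀ * Q * (Qᵀ * C * C * Q) = Qᵀ * (Q * Qᵀ * C) * C * Q := by simp only [Matrix.mul_assoc]
        _ = Qᵀ * C * Q := by rw [hGC, Matrix.mul_one]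
    rw [hH'def, Matrix.add_mul, Matrix.mul_add, Matrix.mul_add, e1, e2, e3, e4, add_zero, zero_add, ← h1P, add_sub_cancel]
  have hH'unit : IsUnit H'.det := by
    exact Matrix.isUnit_det_of_right_inverse hinv
  have hH'inv : H'⁻¹ = ι * A⁻¹ * ιᵀ + Qᵀ * C * C * Q := inv_eq_right_inv hinv
  -- its block propagator is `1`
  have hbp : blockProp H' Q = 1 := by
    rw [blockProp, hH'inv, Matrix.mul_add, Matrix.add_mul]
    have e1 : Q * (ι * A⁻¹ * ιᵀ) * Qᵀ = 0 := by
      calc Q * (ι * A⁻¹ * ιᵀ) * Qᵀ = (Q * ι) * A⁻¹ * ιᵀ * Qᵀ := by simp only [Matrix.mul_assoc]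
        _ = 0 := by rw [hQι]; simp
    have e2 : Q * (Qᵀ * C * C * Q) * Qᵀ = 1 := by
      calc Q * (Qᵀ * C * C * Q) * Qᵀ = (Q * Qᵀ * C) * (C * (Q * Qᵀ)) := by simp only [Matrix.mul_assoc]
        _ = 1 := by rw [hGC, hCG, Matrix.mul_one]
    rw [e1, e2, zero_add]
  -- its determinant by Weinstein–Aronszajn
  have hdetH' : H'.det = A.det * (Q * Qᵀ).det := by
    have eXY : H' = 1 + fromCols ι Qᵀ * fromRows ((A - 1) * ιᵀ) ((1 - C) * Q) := by
      rw [fromCols_mul_fromRows, ← hc, hH'def, hAdef, hPdef]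
      simp only [Matrix.sub_mul, Matrix.mul_sub, Matrix.one_mul, Matrix.mul_assoc]
      abel
    have eYX : fromRows ((A - 1) * ιᵀ) ((1 - C) * Q) * fromCols ι Qᵀ = fromBlocks (A - 1) 0 0 (Q * Qᵀ - 1) := by
      rw [fromRows_mul_fromCols]
      simp only [Matrix.mul_assoc, hιι, hιQ, hQι, Matrix.mul_one, Matrix.mul_zero, Matrix.sub_mul, Matrix.one_mul, hCG, sub_zero]
    rw [eXY, det_one_add_mul_comm, eYX, ← fromBlocks_one, fromBlocks_add]
    simp only [add_zero, add_sub_cancel]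
    rw [det_fromBlocks_zero₂₁]
  -- assemble
  rw [← hdet1, det_kkt' H' Q hH'unit, hbp, det_one, mul_one, hdetH', mul_comm A.det]

/-! ## §2 B5's least squares on `N(Q)`: the minimiser through pv25's `flucCov`, the residual projection, completing the square -/

section LeastSquares

variable (L : Matrix ν ν 𝕜) (Q : Matrix μ ν 𝕜)

/-- [folklore] The constrained least-squares minimiser `lsq b := flucCov (LᵀL) Q (Lᵀ b)` of `‖b − Lλ‖²` over `λ ∈ N(Q)` lies in `N(Q)`
(B5 (1.25): `λ₀ = Δ⁻¹d^*A − Δ⁻²Q′^*(Q′Δ⁻²Q′^*)⁻¹Q′Δ⁻¹d^*A` for symmetric invertible `L = Δ`, by pv25's `flucCov_eq_constrProp`). -/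
theorem mul_lsq_eq_zero (h : IsUnit (kkt (Lᵀ * L) Q).det) (b : ν → 𝕜) : Q *ᵥ (flucCov (Lᵀ * L) Q *ᵥ (Lᵀ *ᵥ b)) = 0 := by
  rw [mulVec_mulVec, mul_flucCov _ _ h, zero_mulVec]

/-- [folklore] `𝒢·(LᵀL)·v = v` for `v ∈ N(Q)` (left block identity of the bordered inverse). -/
theorem flucCov_mulVec_form (h : IsUnit (kkt (Lᵀ * L) Q).det) {v : ν → 𝕜} (hv : Q *ᵥ v = 0) :
    (flucCov (Lᵀ * L) Q * (Lᵀ * L)) *ᵥ v = v := by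
  have h1 := congrArg (fun M => M *ᵥ v) (blocks_mul_kkt (Lᵀ * L) Q h).1
  simp only [add_mulVec, one_mulVec] at h1
  have e : (minOp (Lᵀ * L) Q * Q) *ᵥ v = 0 := by rw [← mulVec_mulVec, hv, mulVec_zero]
  rwa [e, add_zero] at h1

/-- [folklore] **B9's `RΔλ = Δλ` on `N(Q′)`**: the residual operator `resPrj := 1 − L·flucCov(LᵀL) Q·Lᵀ` KILLS `L·N(Q)` —
`(1 − L𝒢Lᵀ)(Lv) = 0` whenever `Qv = 0` (so `R := 1 − resPrj` fixes `L·N(Q)`). -/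
theorem resPrj_mulVec_L (h : IsUnit (kkt (Lᵀ * L) Q).det) {v : ν → 𝕜} (hv : Q *ᵥ v = 0) :
    (1 - L * flucCov (Lᵀ * L) Q * Lᵀ) *ᵥ (L *ᵥ v) = 0 := by
  have key : (L * flucCov (Lᵀ * L) Q * Lᵀ) *ᵥ (L *ᵥ v) = L *ᵥ v := by
    rw [mulVec_mulVec, show L * flucCov (Lᵀ * L) Q * Lᵀ * L = L * (flucCov (Lᵀ * L) Q * (Lᵀ * L)) by
      simp only [Matrix.mul_assoc], ← mulVec_mulVec, flucCov_mulVec_form L Q h hv]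
  rw [sub_mulVec, one_mulVec, key, sub_self]

/-- [folklore] `𝒢·(LᵀL)·𝒢 = 𝒢`. -/
theorem flucCov_form_flucCov (h : IsUnit (kkt (Lᵀ * L) Q).det) :
    flucCov (Lᵀ * L) Q * (Lᵀ * L) * flucCov (Lᵀ * L) Q = flucCov (Lᵀ * L) Q := by
  have h1 := congrArg (fun M => flucCov (Lᵀ * L) Q * M) (kkt_mul_blocks (Lᵀ * L) Q h).1
  simp only [Matrix.mul_add, ← Matrix.mul_assoc, flucCov_mul_transpose _ _ h, Matrix.zero_mul, add_zero, Matrix.mul_one] at h1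
  simpa only [Matrix.mul_assoc] using h1

/-- [folklore] The residual operator is idempotent: `(1 − L𝒢Lᵀ)·(L𝒢Lᵀ) = 0`. -/
theorem resPrj_mul_compl (h : IsUnit (kkt (Lᵀ * L) Q).det) :
    (1 - L * flucCov (Lᵀ * L) Q * Lᵀ) * (L * flucCov (Lᵀ * L) Q * Lᵀ) = 0 := by
  calc (1 - L * flucCov (Lᵀ * L) Q * Lᵀ) * (L * flucCov (Lᵀ * L) Q * Lᵀ)
      = L * flucCov (Lᵀ * L) Q * Lᵀ - L * (flucCov (Lᵀ * L) Q * (Lᵀ * L) * flucCov (Lᵀ * L) Q) * Lᵀ := by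
        simp only [Matrix.sub_mul, Matrix.one_mul, Matrix.mul_assoc]
    _ = 0 := by rw [flucCov_form_flucCov L Q h, sub_self]

/-- [folklore] `resPrj² = resPrj`. -/
theorem resPrj_idem (h : IsUnit (kkt (Lᵀ * L) Q).det) :
    (1 - L * flucCov (Lᵀ * L) Q * Lᵀ) * (1 - L * flucCov (Lᵀ * L) Q * Lᵀ) = 1 - L * flucCov (Lᵀ * L) Q * Lᵀ := by
  rw [Matrix.mul_sub, Matrix.mul_one, resPrj_mul_compl L Q h, sub_zero]

/-- [folklore] `resPrjᵀ = resPrj` (the fluctuation covariance of the symmetric form `LᵀL` is symmetric). -/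
theorem resPrj_transpose : (1 - L * flucCov (Lᵀ * L) Q * Lᵀ)ᵀ = 1 - L * flucCov (Lᵀ * L) Q * Lᵀ := by
  have hS : (Lᵀ * L)ᵀ = Lᵀ * L := by rw [transpose_mul, transpose_transpose]
  have hG : (flucCov (Lᵀ * L) Q)ᵀ = flucCov (Lᵀ * L) Q := (minOpL_eq_transpose (Lᵀ * L) Q hS).2.1
  rw [transpose_sub, transpose_one, transpose_mul, transpose_mul, transpose_transpose, hG, ← Matrix.mul_assoc]

/-- [folklore] **B5 (1.28) EXPLICITLY**: for `L` and the block propagator of `LᵀL` invertible, `resPrj = L⁻ᵀ Qᵀ (Q (LᵀL)⁻¹ Qᵀ)⁻¹ Q L⁻¹`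
(for symmetric `L = Δ`: `Δ⁻¹Q′^*(Q′Δ⁻²Q′^*)⁻¹Q′Δ⁻¹`). -/
theorem resPrj_eq_explicit (hL : IsUnit L.det) (hP : IsUnit (blockProp (Lᵀ * L) Q).det) :
    1 - L * flucCov (Lᵀ * L) Q * Lᵀ = Lᵀ⁻¹ * Qᵀ * (blockProp (Lᵀ * L) Q)⁻¹ * Q * L⁻¹ := by
  have hLt : IsUnit Lᵀ.det := by rwa [det_transpose]
  have hS : IsUnit (Lᵀ * L).det := by rw [det_mul]; exact hLt.mul hL
  have hSinv : (Lᵀ * L)⁻¹ = L⁻¹ * Lᵀ⁻¹ := Matrix.mul_inv_rev Lᵀ L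
  have e2 : L * (Lᵀ * L)⁻¹ = Lᵀ⁻¹ := by rw [hSinv, ← Matrix.mul_assoc, mul_nonsing_inv _ hL, Matrix.one_mul]
  have e3 : (Lᵀ * L)⁻¹ * Lᵀ = L⁻¹ := by rw [hSinv, Matrix.mul_assoc, nonsing_inv_mul _ hLt, Matrix.mul_one]
  have e1 : L * (Lᵀ * L)⁻¹ * Lᵀ = 1 := by rw [e2, nonsing_inv_mul _ hLt]
  rw [CompositionSingular.flucCov_eq_constrProp _ _ hS hP]
  unfold Envelope.constrProp Envelope.minMap
  calc 1 - L * ((Lᵀ * L)⁻¹ - (Lᵀ * L)⁻¹ * Qᵀ * (blockProp (Lᵀ * L) Q)⁻¹ * Q * (Lᵀ * L)⁻¹) * Lᵀ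
      = 1 - L * (Lᵀ * L)⁻¹ * Lᵀ + (L * (Lᵀ * L)⁻¹) * Qᵀ * (blockProp (Lᵀ * L) Q)⁻¹ * Q * ((Lᵀ * L)⁻¹ * Lᵀ) := by
        simp only [Matrix.mul_sub, Matrix.sub_mul, Matrix.mul_assoc]
        abel
    _ = Lᵀ⁻¹ * Qᵀ * (blockProp (Lᵀ * L) Q)⁻¹ * Q * L⁻¹ := by rw [e1, e2, e3, sub_self, zero_add]

end LeastSquares

section Square

variable (L : Matrix ν ν ℝ) (Q : Matrix μ ν ℝ)

/-- [folklore] **COMPLETING THE SQUARE ON `N(Q)`** (B5 (1.24)–(1.26)): for every `λ` with `Qλ = 0`,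
`‖b − Lλ‖² = ‖resPrj b‖² + ‖L(λ − lsq b)‖²` — the ghost Gaussian `∫_{N(Q)} e^{−‖b−Lλ‖²∕2α}dλ` is the weight `e^{−‖resPrj b‖²∕2α}` times a
`b`-INDEPENDENT volume. -/
theorem normSq_residual (h : IsUnit (kkt (Lᵀ * L) Q).det) (b lam : ν → ℝ) (hlam : Q *ᵥ lam = 0) :
    (b - L *ᵥ lam) ⬝ᵥ (b - L *ᵥ lam)
      = ((1 - L * flucCov (Lᵀ * L) Q * Lᵀ) *ᵥ b) ⬝ᵥ ((1 - L * flucCov (Lᵀ * L) Q * Lᵀ) *ᵥ b)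
        + (L *ᵥ (lam - flucCov (Lᵀ * L) Q *ᵥ (Lᵀ *ᵥ b))) ⬝ᵥ (L *ᵥ (lam - flucCov (Lᵀ * L) Q *ᵥ (Lᵀ *ᵥ b))) := by
  set Pr : Matrix ν ν ℝ := 1 - L * flucCov (Lᵀ * L) Q * Lᵀ with hPr
  set l0 : ν → ℝ := flucCov (Lᵀ * L) Q *ᵥ (Lᵀ *ᵥ b) with hl0
  -- decomposition of the residual
  have hPrb : Pr *ᵥ b = b - L *ᵥ l0 := by
    rw [hPr, sub_mulVec, one_mulVec, hl0, ← mulVec_mulVec, ← mulVec_mulVec]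
  have hsplit : b - L *ᵥ lam = Pr *ᵥ b - L *ᵥ (lam - l0) := by
    rw [hPrb, mulVec_sub]
    abel
  -- orthogonality `⟪Π b, L u⟫ = 0` for `u ∈ N(Q)`
  have hu : Q *ᵥ (lam - l0) = 0 := by rw [mulVec_sub, hlam, hl0, mul_lsq_eq_zero L Q h, sub_zero]
  have horth : (Pr *ᵥ b) ⬝ᵥ (L *ᵥ (lam - l0)) = 0 := by
    have e : Pr *ᵥ b = b ᵥ* Pr := by rw [← vecMul_transpose, hPr, resPrj_transpose]
    rw [e, ← dotProduct_mulVec, hPr, resPrj_mulVec_L L Q h hu, dotProduct_zero]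
  have horth' : (L *ᵥ (lam - l0)) ⬝ᵥ (Pr *ᵥ b) = 0 := by rw [dotProduct_comm, horth]
  rw [hsplit, sub_dotProduct, dotProduct_sub, dotProduct_sub, horth, horth']
  ring

end Square

/-! ## §3 The ghost log-determinant and its three readings -/

section Ghost

variable (L : Matrix ν ν ℝ) (Q : Matrix μ ν ℝ)

/-- [our object] **THE GHOST LOG-DETERMINANT (model)**: `ghostLogDet L Q := ½·(log|det kkt (LᵀL) Q| − log|det(QQᵀ)|)` — the basis-free
`log|det(L : N(Q) → L·N(Q))|` (§3(a)); by R-FP-18 (b) the MODEL of B9 (3.121)'s `log|det(Δ_U↾N(Q′))|` at `L := Δ_U`, `Q := Q′`. -/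
def ghostLogDet (L : Matrix ν ν ℝ) (Q : Matrix μ ν ℝ) : ℝ :=
  (1 / 2 : ℝ) * (Real.log |(kkt (Lᵀ * L) Q).det| - Real.log |(Q * Qᵀ).det|)

omit [DecidableEq κ] in
/-- [folklore] The compression lemma in logarithmic form: `log|det kkt K Q| − log|det QQᵀ| = log|det(ιᵀKι)|` for every orthonormal kernel frame. -/
theorem log_abs_det_kkt_eq_frame [DecidableEq κ] (K : Matrix ν ν ℝ) (ι : Matrix ν κ ℝ) (hιι : ιᵀ * ι = 1) (hQι : Q * ι = 0)
    (hG : IsUnit (Q * Qᵀ).det) (hc : ι * ιᵀ + Qᵀ * (Q * Qᵀ)⁻¹ * Q = 1) (hA : IsUnit (ιᵀ * K * ι).det) :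
    Real.log |(kkt K Q).det| - Real.log |(Q * Qᵀ).det| = Real.log |(ιᵀ * K * ι).det| := by
  rw [det_kkt_eq_frame K Q ι hιι hQι hG hc hA, abs_mul, abs_mul, abs_pow, abs_neg, abs_one, one_pow, one_mul,
    Real.log_mul (abs_ne_zero.2 hG.ne_zero) (abs_ne_zero.2 hA.ne_zero)]
  ring

/-- [folklore] **(a) THE FACTOR OF (3.121)**: `ghostLogDet L Q = ½·log|det(ιᵀLᵀLι)|` — the log-volume ratio of `L : N(Q) → L·N(Q)`
(`ιᵀLᵀLι` = the Gram matrix of `L` on an orthonormal frame of `N(Q)`; B9's `R`-plane contains `L·N(Q)` by «`RΔλ = Δλ`»). -/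
theorem ghostLogDet_eq_frame (ι : Matrix ν κ ℝ) (hιι : ιᵀ * ι = 1) (hQι : Q * ι = 0) (hG : IsUnit (Q * Qᵀ).det)
    (hc : ι * ιᵀ + Qᵀ * (Q * Qᵀ)⁻¹ * Q = 1) (hA : IsUnit (ιᵀ * (Lᵀ * L) * ι).det) :
    ghostLogDet L Q = (1 / 2 : ℝ) * Real.log |(ιᵀ * (Lᵀ * L) * ι).det| := by
  rw [ghostLogDet, log_abs_det_kkt_eq_frame Q (Lᵀ * L) ι hιι hQι hG hc hA]

/-- [folklore] **(b) JACOBI ∕ B5 (1.26) FORM**: `ghostLogDet L Q = log|det L| + ½·log|det(Q(LᵀL)⁻¹Qᵀ)| − ½·log|det QQᵀ|` — the operator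
`Q′Δ⁻²Q′^*` of (1.26) (pv25's `det_kkt'` on the invertible form `LᵀL`). -/
theorem ghostLogDet_eq_jacobi (hL : IsUnit L.det) (hP : IsUnit (blockProp (Lᵀ * L) Q).det) :
    ghostLogDet L Q = Real.log |L.det| + (1 / 2 : ℝ) * Real.log |(blockProp (Lᵀ * L) Q).det| - (1 / 2 : ℝ) * Real.log |(Q * Qᵀ).det| := by
  have hS : IsUnit (Lᵀ * L).det := by rw [det_mul, det_transpose]; exact hL.mul hL
  have hdetS : |(Lᵀ * L).det| = |L.det| * |L.det| := by rw [det_mul, det_transpose, abs_mul]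
  have hL0 : |L.det| ≠ 0 := abs_ne_zero.2 hL.ne_zero
  rw [ghostLogDet, det_kkt' _ _ hS, abs_mul, abs_mul, abs_pow, abs_neg, abs_one, one_pow, one_mul, hdetS,
    Real.log_mul (mul_ne_zero hL0 hL0) (abs_ne_zero.2 hP.ne_zero), Real.log_mul hL0 hL0]
  ring

/-- [folklore] **(c) THE TYPED GAUSSIAN**: pv25's `logZ` (the cell's algebraic model of `log ∫ δ(Qλ) e^{−½⟨λ,Kλ⟩}dλ`) at the ghost form
`K := LᵀL` IS minus the ghost log-determinant up to the constraint Gram constant: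
`logZ (LᵀL) Q = ((|ν|−|μ|)∕2)·log 2π − ghostLogDet L Q − ½·log|det QQᵀ|`. -/
theorem logZ_transpose_mul_self :
    logZ (Lᵀ * L) Q = ((Fintype.card ν : ℝ) - Fintype.card μ) / 2 * Real.log (2 * Real.pi) - ghostLogDet L Q
      - (1 / 2 : ℝ) * Real.log |(Q * Qᵀ).det| := by
  rw [logZ, ghostLogDet]
  ring

/-- [folklore] **(d) (R7) THE COMPRESSION ALTERNATIVE**: `log|det kkt L Q| − log|det QQᵀ| = log|det(ιᵀLι)|` — the determinant of the
COMPRESSION `P_N L P_N`; for invertible `L` with `Q L⁻¹ Qᵀ` invertible it is `log|det L| + log|det(QL⁻¹Qᵀ)| − log|det QQᵀ|` — to be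
compared with (a)∕(b): the two differ in general (`frame_example`). -/
theorem compression_eq_jacobi (hL : IsUnit L.det) (hP : IsUnit (blockProp L Q).det) :
    Real.log |(kkt L Q).det| - Real.log |(Q * Qᵀ).det| = Real.log |L.det| + Real.log |(blockProp L Q).det| - Real.log |(Q * Qᵀ).det| := by
  rw [det_kkt' _ _ hL, abs_mul, abs_mul, abs_pow, abs_neg, abs_one, one_pow, one_mul,
    Real.log_mul (abs_ne_zero.2 hL.ne_zero) (abs_ne_zero.2 hP.ne_zero)]

/-- [folklore] **(R7) WITNESS**: on `ν = Fin 2` with the frame `ι = e₂` of `N(Q)`, `Q = (1 0)`, and the symmetric invertible `L = [[1,1],[1,2]]`: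
the Gram determinant `det(ιᵀLᵀLι) = 5` while the compression determinant `det(ιᵀLι) = 2` — so `|det(L↾N(Q) → L·N(Q))| = √5 ≠ 2`. -/
theorem frame_example :
    Matrix.det (((!![0; 1] : Matrix (Fin 2) (Fin 1) ℚ))ᵀ * (((!![1, 1; 1, 2] : Matrix (Fin 2) (Fin 2) ℚ))ᵀ * (!![1, 1; 1, 2] : Matrix (Fin 2) (Fin 2) ℚ))
        * (!![0; 1] : Matrix (Fin 2) (Fin 1) ℚ)) = 5
      ∧ Matrix.det (((!![0; 1] : Matrix (Fin 2) (Fin 1) ℚ))ᵀ * (!![1, 1; 1, 2] : Matrix (Fin 2) (Fin 2) ℚ)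
        * (!![0; 1] : Matrix (Fin 2) (Fin 1) ℚ)) = 2 := by
  constructor <;> · rw [Matrix.det_unique]; norm_num [Matrix.mul_apply, Fin.sum_univ_two]

end Ghost

end

end Summit.QuantumFields.BalabanUV.Beta.FP.GhostDeterminantModel
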